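import Summits.CriticalPhenomena.PercolationContinuityZ3.Theorems.PercRayRenewalJumpLineAvoidanceDecayTwoPointPointwise
import HarnessLib

/-!
# Truncated one-arm power decay forces a power saving in the ball two-point sum

Route `PercRayRenewal`, item `JumpLineAvoidanceDecay` (stmt-CriticalPhenomena-4626), helper file.
For nearest-neighbour bond percolation on `ℤ³` at ANY density `p`: if the truncated one-arm
probability `π^f_n = P_p({0 ↔ ∂Λ_n} ∖ {0 ↔ ∞})` decays like a power, `π^f_n ≤ C n^{-a}` for all
`n ≥ 1` (some `a > 0`), then the ball sums of the connected two-point function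
`τ_p(0, x) - θ(p)²` (`τ_p(0, x) = P_p(0 ↔ x)`, `θ(p) = P_p(0 ↔ ∞)`) enjoy an "infrared-type" power
saving over the volume: `Σ_{x ∈ Λ_R} (τ_p(0, x) - θ(p)²) ≤ C' R^{3-a'}` for all `R ≥ 1`, with
`a' = min(a/2, 3/2) > 0` and `C' = 125 + 81 · 2^a · C` (`Λ_R = {-R, …, R}³`).

Proof. Fix `R ≥ 1` and the mesoscopic scale `k = ⌊R^{1/2}⌋ ≥ 1` (`k ≤ R^{1/2} < k + 1 ≤ 2k`).
Pointwise, `τ_p(0, x) - θ² ≤ 1` for every `x` (a probability is at most one, `θ² ≥ 0`), and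
`τ_p(0, x) - θ² ≤ 3 π^f_k` for `x ∉ Λ_{2k}` (the engine
`real_openConn_sub_sq_le_three_mul_truncArm` of the sibling file `…TwoPointPointwise`). Hence
`τ_p(0, x) - θ² ≤ 1_{Λ_{2k}}(x) + 3 π^f_k` for all `x` and, summing over `Λ_R`,
`Σ_{x ∈ Λ_R} (τ_p(0, x) - θ²) ≤ |Λ_{2k}| + 3 |Λ_R| π^f_k`. Numerically `|Λ_{2k}| = (4k+1)³ ≤
(5 R^{1/2})³ = 125 R^{3/2}`, `|Λ_R| = (2R+1)³ ≤ 27 R³` and `π^f_k ≤ C k^{-a} ≤ C (R^{1/2}/2)^{-a}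
= C 2^a R^{-a/2}`, so the sum is at most `125 R^{3/2} + 81 · 2^a · C · R^{3-a/2} ≤ C' R^{3-a'}`
(`R ≥ 1`, `3/2 ≤ 3 - a'`, `3 - a/2 ≤ 3 - a'`).

## References

* G. Grimmett, *Percolation*, 2nd ed., Grundlehren 321, Springer 1999, §8.5 p. 213 (the split of
  the two-point function into its truncated part and the infinite-cluster part), §1.4
  (`θ(p) ≤ P_p(0 ↔ ∂B(n))`) [GrimmettPercolation1999].
-/

noncomputable section

namespace Summit.CriticalPhenomena.PercolationContinuityZ3.Theorems

open MeasureTheory Literature.Probability.Percolation Literature.Probability.LatticeModels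

namespace BallTwoPoint

/-- **Pointwise domination.** For every `x ∈ ℤ^d` and every scale `k`,
`τ_p(0, x) - θ(p)² ≤ 1_{Λ_{2k}}(x) + 3 π^f_k`: inside `Λ_{2k}` use `τ_p(0, x) ≤ 1`, `θ² ≥ 0`,
`π^f_k ≥ 0`; outside `Λ_{2k}` use the engine `real_openConn_sub_sq_le_three_mul_truncArm`.
[folklore] -/
theorem openConn_sub_sq_le_ite (d : ℕ) (p : unitInterval) (k : ℕ) (x : Site d) :
    (bondPercolation (zdGraph d) p).real (openConn (0 : Site d) x) -
        theta (zdGraph d) (0 : Site d) p ^ 2 ≤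
      (if x ∈ box d (2 * k) then (1 : ℝ) else 0) +
        3 * (bondPercolation (zdGraph d) p).real (siteToBoundary d k \ percolatesAt 0) := by
  have hπ0 : 0 ≤ (bondPercolation (zdGraph d) p).real (siteToBoundary d k \ percolatesAt 0) :=
    measureReal_nonneg
  by_cases hx : x ∈ box d (2 * k)
  · rw [if_pos hx]
    have h1 : (bondPercolation (zdGraph d) p).real (openConn (0 : Site d) x) ≤ 1 :=
      measureReal_le_one
    have h2 : 0 ≤ theta (zdGraph d) (0 : Site d) p ^ 2 := sq_nonneg _
    linarith
  · rw [if_neg hx]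
    have h := real_openConn_sub_sq_le_three_mul_truncArm p hx
    linarith

/-- **The ball sum at scale `k`.** Summing the pointwise domination `openConn_sub_sq_le_ite` over
`Λ_R`: `Σ_{x ∈ Λ_R} (τ_p(0, x) - θ(p)²) ≤ |Λ_R ∩ Λ_{2k}| + 3 |Λ_R| π^f_k ≤ |Λ_{2k}| + 3 |Λ_R| π^f_k`
(`|Λ_R ∩ Λ_{2k}| ≤ |Λ_{2k}|`). [folklore] -/
theorem sum_box_le (d : ℕ) (p : unitInterval) (k R : ℕ) :
    ∑ x ∈ box d R, ((bondPercolation (zdGraph d) p).real (openConn (0 : Site d) x) -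
        theta (zdGraph d) (0 : Site d) p ^ 2) ≤
      ((box d (2 * k)).card : ℝ) + ((box d R).card : ℝ) *
        (3 * (bondPercolation (zdGraph d) p).real (siteToBoundary d k \ percolatesAt 0)) := by
  calc ∑ x ∈ box d R, ((bondPercolation (zdGraph d) p).real (openConn (0 : Site d) x) -
          theta (zdGraph d) (0 : Site d) p ^ 2)
      ≤ ∑ x ∈ box d R, ((if x ∈ box d (2 * k) then (1 : ℝ) else 0) +
          3 * (bondPercolation (zdGraph d) p).real (siteToBoundary d k \ percolatesAt 0)) :=
        Finset.sum_le_sum fun x _ => openConn_sub_sq_le_ite d p k x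
    _ = (((box d R).filter (· ∈ box d (2 * k))).card : ℝ) + ((box d R).card : ℝ) *
          (3 * (bondPercolation (zdGraph d) p).real (siteToBoundary d k \ percolatesAt 0)) := by
        rw [Finset.sum_add_distrib, Finset.sum_boole, Finset.sum_const, nsmul_eq_mul]
    _ ≤ _ :=
        add_le_add (Nat.cast_le.2 (Finset.card_le_card fun x hx => (Finset.mem_filter.1 hx).2))
          le_rfl

end BallTwoPoint

open BallTwoPoint in
/-- **Truncated one-arm power decay ⇒ ball two-point power saving** (any `p`, `d = 3`): if
`P_p({0 ↔ ∂Λ_n} ∖ {0 ↔ ∞}) ≤ C n^{-a}` for all `n ≥ 1` (some `a > 0`), then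
`Σ_{x ∈ Λ_R} (τ_p(0, x) - θ(p)²) ≤ (125 + 81 · 2^a · C) R^{3 - min(a/2, 3/2)}` for all `R ≥ 1`.
The ball sum at the scale `k = ⌊R^{1/2}⌋` (`BallTwoPoint.sum_box_le`), the hypothesis at `n = k`,
and the bookkeeping `(4k+1)³ ≤ 125 R^{3/2}`, `(2R+1)³ ≤ 27 R³`, `k^{-a} ≤ 2^a R^{-a/2}`,
`R^{3/2}, R^{3-a/2} ≤ R^{3-a'}`. [folklore] -/
theorem ballTwoPointPowerSaving_of_truncArmDecay (p : unitInterval)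
    (hπ : ∃ a C : ℝ, 0 < a ∧ ∀ n : ℕ, 1 ≤ n →
      (bondPercolation (zdGraph 3) p).real (siteToBoundary 3 n \ percolatesAt 0) ≤
        C * (n : ℝ) ^ (-a)) :
    ∃ a C : ℝ, 0 < a ∧ ∀ R : ℕ, 1 ≤ R →
      ∑ x ∈ box 3 R, ((bondPercolation (zdGraph 3) p).real (openConn (0 : Site 3) x) -
        theta (zdGraph 3) (0 : Site 3) p ^ 2) ≤ C * (R : ℝ) ^ (3 - a) := by
  obtain ⟨a, C, ha, hC⟩ := hπ
  -- the constant is non-negative (instance `n = 1`)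
  have hC0 : 0 ≤ C := by
    have h := hC 1 le_rfl
    simp only [Nat.cast_one, Real.one_rpow, mul_one] at h
    exact le_trans measureReal_nonneg h
  -- the exponent
  set m : ℝ := min (a / 2) (3 / 2) with hm
  have hm0 : 0 < m := lt_min (by linarith) (by norm_num)
  have hma : m ≤ a / 2 := min_le_left _ _
  have hm3 : m ≤ 3 / 2 := min_le_right _ _
  refine ⟨m, 125 + 81 * (2 : ℝ) ^ a * C, hm0, fun R hR => ?_⟩
  have hR0 : (0 : ℝ) < R := by exact_mod_cast hR
  have hR1 : (1 : ℝ) ≤ R := by exact_mod_cast hR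
  -- the scale `k = ⌊R^{1/2}⌋ ≥ 1`
  set x : ℝ := (R : ℝ) ^ (1 / 2 : ℝ) with hx
  have hx1 : 1 ≤ x := Real.one_le_rpow hR1 (by norm_num)
  have hx0 : 0 < x := lt_of_lt_of_le one_pos hx1
  set k : ℕ := ⌊x⌋₊ with hk
  have hk1 : 1 ≤ k := Nat.le_floor (by exact_mod_cast hx1)
  have hk1' : (1 : ℝ) ≤ k := by exact_mod_cast hk1
  have hkx : (k : ℝ) ≤ x := Nat.floor_le hx0.le
  have hxk : x < k + 1 := Nat.lt_floor_add_one x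
  -- `|Λ_{2k}| = (4k+1)³ ≤ (5x)³ = 125 R^{3/2}`
  have hcard1 : ((box 3 (2 * k)).card : ℝ) ≤ 125 * (R : ℝ) ^ (3 / 2 : ℝ) := by
    rw [card_box]
    push_cast
    have h1 : 2 * (2 * (k : ℝ)) + 1 ≤ 5 * x := by linarith
    have h3 : x ^ (3 : ℕ) = (R : ℝ) ^ (3 / 2 : ℝ) := by
      rw [hx, ← Real.rpow_natCast, ← Real.rpow_mul hR0.le]
      norm_num
    calc (2 * (2 * (k : ℝ)) + 1) ^ 3 ≤ (5 * x) ^ 3 := pow_le_pow_left₀ (by positivity) h1 3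
      _ = 125 * x ^ 3 := by ring
      _ = 125 * (R : ℝ) ^ (3 / 2 : ℝ) := by rw [h3]
  -- `|Λ_R| = (2R+1)³ ≤ 27 R³`
  have hcard2 : ((box 3 R).card : ℝ) ≤ 27 * (R : ℝ) ^ (3 : ℕ) := by
    rw [card_box]
    push_cast
    have h1 : 2 * (R : ℝ) + 1 ≤ 3 * R := by linarith
    calc (2 * (R : ℝ) + 1) ^ 3 ≤ (3 * (R : ℝ)) ^ 3 := pow_le_pow_left₀ (by positivity) h1 3
      _ = 27 * (R : ℝ) ^ 3 := by ring
  -- `π^f_k ≤ C k^{-a} ≤ C 2^a R^{-a/2}` from `R^{1/2} < k + 1 ≤ 2k`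
  have hπk : (bondPercolation (zdGraph 3) p).real (siteToBoundary 3 k \ percolatesAt 0) ≤
      C * ((2 : ℝ) ^ a * (R : ℝ) ^ (-(a / 2))) := by
    have hx2k : x / 2 ≤ k := by linarith
    have hx2 : 0 < x / 2 := by positivity
    have h1 : (k : ℝ) ^ (-a) ≤ (x / 2) ^ (-a) :=
      Real.rpow_le_rpow_of_nonpos hx2 hx2k (by linarith)
    have h2 : (x / 2) ^ (-a) = (2 : ℝ) ^ a * x ^ (-a) := by
      rw [Real.div_rpow hx0.le (by norm_num : (0 : ℝ) ≤ 2),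
        Real.rpow_neg (by norm_num : (0 : ℝ) ≤ 2), div_inv_eq_mul, mul_comm]
    have h3 : x ^ (-a) = (R : ℝ) ^ (-(a / 2)) := by
      rw [hx, ← Real.rpow_mul hR0.le]
      congr 1
      ring
    calc (bondPercolation (zdGraph 3) p).real (siteToBoundary 3 k \ percolatesAt 0)
        ≤ C * (k : ℝ) ^ (-a) := hC k hk1
      _ ≤ C * (x / 2) ^ (-a) := mul_le_mul_of_nonneg_left h1 hC0
      _ = C * ((2 : ℝ) ^ a * (R : ℝ) ^ (-(a / 2))) := by rw [h2, h3]
  -- `R^{3/2} ≤ R^{3-m}` and `R³ R^{-a/2} ≤ R^{3-m}`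
  have he1 : (R : ℝ) ^ (3 / 2 : ℝ) ≤ (R : ℝ) ^ (3 - m) :=
    Real.rpow_le_rpow_of_exponent_le hR1 (by linarith)
  have he2 : (R : ℝ) ^ (3 : ℕ) * (R : ℝ) ^ (-(a / 2)) ≤ (R : ℝ) ^ (3 - m) := by
    have h : (R : ℝ) ^ (3 : ℕ) * (R : ℝ) ^ (-(a / 2)) = (R : ℝ) ^ ((3 : ℝ) + -(a / 2)) := by
      rw [Real.rpow_add hR0, Real.rpow_ofNat]
    rw [h]
    exact Real.rpow_le_rpow_of_exponent_le hR1 (by linarith)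
  have hπ0 : 0 ≤ (bondPercolation (zdGraph 3) p).real (siteToBoundary 3 k \ percolatesAt 0) :=
    measureReal_nonneg
  have h2a : 0 ≤ (2 : ℝ) ^ a := Real.rpow_nonneg (by norm_num) _
  -- assemble
  calc ∑ x ∈ box 3 R, ((bondPercolation (zdGraph 3) p).real (openConn (0 : Site 3) x) -
          theta (zdGraph 3) (0 : Site 3) p ^ 2)
      ≤ ((box 3 (2 * k)).card : ℝ) + ((box 3 R).card : ℝ) *
          (3 * (bondPercolation (zdGraph 3) p).real (siteToBoundary 3 k \ percolatesAt 0)) :=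
        sum_box_le 3 p k R
    _ ≤ 125 * (R : ℝ) ^ (3 / 2 : ℝ) +
          27 * (R : ℝ) ^ (3 : ℕ) * (3 * (C * ((2 : ℝ) ^ a * (R : ℝ) ^ (-(a / 2))))) :=
        add_le_add hcard1 (mul_le_mul hcard2 (mul_le_mul_of_nonneg_left hπk (by norm_num))
          (mul_nonneg (by norm_num) hπ0) (by positivity))
    _ = 125 * (R : ℝ) ^ (3 / 2 : ℝ) +
          81 * (2 : ℝ) ^ a * C * ((R : ℝ) ^ (3 : ℕ) * (R : ℝ) ^ (-(a / 2))) := by ring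
    _ ≤ 125 * (R : ℝ) ^ (3 - m) + 81 * (2 : ℝ) ^ a * C * (R : ℝ) ^ (3 - m) :=
        add_le_add (mul_le_mul_of_nonneg_left he1 (by norm_num))
          (mul_le_mul_of_nonneg_left he2 (by positivity))
    _ = (125 + 81 * (2 : ℝ) ^ a * C) * (R : ℝ) ^ (3 - m) := by ring

end Summit.CriticalPhenomena.PercolationContinuityZ3.Theorems

end
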